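import Summits.CriticalPhenomena.PercolationContinuityZ3.Theorems.PercNearOneGluingNoHeavyLowerTailGroupThreePointLBMaps
import Summits.CriticalPhenomena.PercolationContinuityZ3.Theorems.PercNearOneGluingNoHeavyLowerTailFourPointAtoms
import HarnessLib

/-!
# `NoHeavyLowerTail` (stmt-CriticalPhenomena-4575) — the FINITE RELAXATION of three-copy switching certificates, I:
# terminal types of finitary configurations and the output rules (F1/F2 clean, F4 messy) at the level of types

Support file (prover prim-cert-2 gen 11; `--supports stmt-CriticalPhenomena-4575`).  No named facts, no sorries.

The switching certificates of the `NoHeavyLowerTail` programme (prim-l12-p1 PROOF-GR3 / PROOF-E1 / PROOF-B, prim-lit-2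
PROOF-3PTLB, prim-e3grp PROOF-TINC) prove `E₃ ≥ 0` rows by `S := λ₀(X,Y,Z) + Σ_p λ_p(Φ_p(X,Y,Z)) ≤ 0` POINTWISE plus
measure preservation.  The pointwise lemma is established by maximising `S` over a FINITE RELAXATION into which every
`(graph, X, Y, Z)` maps (prim-l12-p1 ABSTRACT-SOUNDNESS-3PTLB.md): the potentials read the set partitions ("types", 15 of
them) induced on four marked terminals `τ : Fin 4 → V`, and the output types of the programs obey facts F1/F2/F4 of the
cluster calculus (`…ThreePointLBSwitchingClusters`, `…GroupThreePointLBClusters`).  This file is the semantic half of a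
GENERIC Lean replay of such certificates (part II `…SwitchRelaxCheck` is the kernel checker and its soundness):

* `ftype τ K : Fin 15` — the type of the finitary configuration `K` at the terminals, as an index into
  `FourPointAtoms.pat4`; `jn t i j` = "`i, j` in one block of `t`"; `jn_ftype_iff : jn (ftype τ K) i j ↔ τ j ∈ cl K (τ i)`;
* `refines_ftype_of_subset` (monotonicity), `inW` / `inW_ftype_iff` (terminals inside the explored union of clusters
  `W = clS X (roots τ U)`), `rootBlock_ftype` (a terminal inside `W` is alone in `T ∖ touch W`), `clS_roots_subset_of_mask`;
* CLEAN outputs `X on touch W, T elsewhere`: `admClean`, `admClean_ftype` — inside `W` the blocks are the `X`-blocks (F1),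
  outside they are the blocks of `T ∖ touch W` (F2), none crosses;
* MESSY outputs `X on touch (cl X v) ∖ touch W, T elsewhere` (`v ∉ W`): `admMessy`, `admMessy_ftype` — the `X`-block of `v`
  survives (F4 i), `T`-paths avoiding `cl X v` survive (F4 ii), and every further join passes THROUGH the cluster of `v`
  (`mem_cl_sdiff_touch_of_not_mem_cl`, new); for `v ∈ W` the output is `T`.
-/

noncomputable section

namespace Summit.CriticalPhenomena.PercolationContinuityZ3.Theorems

namespace SwitchRelax

open Finset Literature.Probability.Percolation Literature.Probability.Percolation.DecisionTree
open Literature.Probability.Percolation.Gladkov ThreePointLB GroupThreePointLB FourPointAtoms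
open Summit.CriticalPhenomena.PercolationContinuityZ3.Cruxes.AdditiveGluing.TieLine.ConnAtoms
open scoped Classical

/-! ### Types of four terminals (combinatorial side) -/

/-- A type is an index into the table `FourPointAtoms.pat4` of the 15 set partitions of `Fin 4`. [folklore] -/
abbrev Ty := Fin 15

/-- `jn t i j`: terminals `i, j` lie in one block of type `t`. [folklore] -/
def jn (t : Ty) (i j : Fin 4) : Bool := decide (pat4 t i = pat4 t j)

/-- `refines p t`: every block of `p` lies inside a block of `t`. [folklore] -/
def refines (p t : Ty) : Bool := decide (∀ i j : Fin 4, jn p i j = true → jn t i j = true)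

/-- `inW πX U i`: terminal `i` is `πX`-joined to a root terminal of `U` (lies in the explored union of `X`-clusters). [folklore] -/
def inW (πX : Ty) (U : Finset (Fin 4)) (i : Fin 4) : Bool := decide (∃ u ∈ U, jn πX u i = true)

/-- Admissible CLEAN output type `q`, given the input type `πX`, the mask `m` of the sealed union `W` and the type `p` of
`T ∖ touch W`: inside `W` the `X`-blocks, outside `W` the blocks of `p`, nothing across. [folklore] -/
def admClean (πX : Ty) (m : Fin 4 → Bool) (p q : Ty) : Bool :=
  decide (∀ i j : Fin 4, jn q i j = (m i && jn πX i j || !m i && (!m j && jn p i j)))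

/-- Admissible MESSY output type `q` for a second step rooted at `v` after a first step with mask `mA`, given the type
`t` of `T` and the type `p` of `T ∖ touch (cl X v)`: if `v` is inside the first union the output is `T`; otherwise (M1) the
`πX`-block of `v` is one block, (M2) blocks of `p` are joined, (M3) a join not present in `p` goes through `v`. [folklore] -/
def admMessy (πX : Ty) (mA : Fin 4 → Bool) (v : Fin 4) (t p q : Ty) : Bool :=
  (mA v && decide (q = t)) ||
  (!mA v && decide ((∀ i j : Fin 4, jn πX v i = true → jn πX v j = true → jn q i j = true) ∧
      (∀ i j : Fin 4, jn p i j = true → jn q i j = true) ∧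
      (∀ i j : Fin 4, jn q i j = true → jn p i j = false → jn q i v = true)))

/-! ### The type of a finitary configuration -/

variable {V : Type*} [Fintype V] [DecidableEq V] (τ : Fin 4 → V)

omit [DecidableEq V] in
/-- The terminal relation "`τ j` lies in the open `K`-cluster of `τ i`" is an equivalence relation. [folklore] -/
theorem rel_equivalence (K : Finset (Sym2 V)) : Equivalence (fun i j : Fin 4 => τ j ∈ cl K (τ i)) :=
  ⟨fun i => mem_cl_self K (τ i), fun h => mem_cl_comm.1 h, fun h h' => mem_cl_trans h h'⟩

omit [DecidableEq V] in
/-- Every canonical labeling of `Fin 4` is a row of `pat4`. [folklore] -/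
theorem exists_pat4_eq {π : Fin 4 → Fin 4} (hπ : IsCanon π) : ∃ t : Ty, pat4 t = π := by
  have h : π ∈ Finset.univ.image pat4 := by rw [image_pat4]; exact mem_canonSet.2 hπ
  obtain ⟨t, _, ht⟩ := Finset.mem_image.1 h
  exact ⟨t, ht⟩

/-- **The type** of the configuration `K` at the terminals `τ` (index of its canonical labeling in `pat4`). [this work] -/
def ftype (K : Finset (Sym2 V)) : Ty :=
  (exists_pat4_eq (isCanon_canonOf (rel_equivalence τ K))).choose

omit [DecidableEq V] in
/-- Defining property of `ftype`. [this work] -/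
theorem pat4_ftype (K : Finset (Sym2 V)) : pat4 (ftype τ K) = canonOf (fun i j : Fin 4 => τ j ∈ cl K (τ i)) :=
  (exists_pat4_eq (isCanon_canonOf (rel_equivalence τ K))).choose_spec

omit [DecidableEq V] in
/-- **`jn (ftype τ K) i j` says "`τ j` is in the `K`-cluster of `τ i`".** [this work] -/
theorem jn_ftype_iff (K : Finset (Sym2 V)) (i j : Fin 4) : jn (ftype τ K) i j = true ↔ τ j ∈ cl K (τ i) := by
  rw [jn, decide_eq_true_iff, pat4_ftype, canonOf_eq_iff (rel_equivalence τ K)]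

omit [DecidableEq V] in
/-- Transport of a Boolean identity between two `jn` values through their meanings. [folklore] -/
theorem jn_eq_jn_of_iff {K L : Finset (Sym2 V)} {i j i' j' : Fin 4}
    (h : τ j ∈ cl K (τ i) ↔ τ j' ∈ cl L (τ i')) : jn (ftype τ K) i j = jn (ftype τ L) i' j' := by
  rw [Bool.eq_iff_iff, jn_ftype_iff, jn_ftype_iff]; exact h

omit [DecidableEq V] in
/-- **Monotonicity.** A sub-configuration has a finer type. [this work] -/
theorem refines_ftype_of_subset {K L : Finset (Sym2 V)} (h : K ⊆ L) : refines (ftype τ K) (ftype τ L) = true := by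
  rw [refines, decide_eq_true_iff]
  intro i j hij
  rw [jn_ftype_iff] at hij ⊢
  exact cl_mono h _ hij

/-! ### Root sets and the explored union of clusters -/

/-- The root vertices of an index set. [folklore] -/
def roots (U : Finset (Fin 4)) : Finset V := U.image τ

/-- **`inW` read semantically**: terminal `i` lies in `clS X (roots τ U)` iff it is `X`-joined to a root of `U`. [this work] -/
theorem inW_ftype_iff (X : Finset (Sym2 V)) (U : Finset (Fin 4)) (i : Fin 4) :
    inW (ftype τ X) U i = true ↔ τ i ∈ clS X (roots τ U) := by
  rw [inW, decide_eq_true_iff, mem_clS]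
  constructor
  · rintro ⟨u, hu, h⟩
    exact ⟨τ u, Finset.mem_image_of_mem τ hu, (jn_ftype_iff τ X u i).1 h⟩
  · rintro ⟨a, ha, h⟩
    obtain ⟨u, hu, rfl⟩ := Finset.mem_image.1 ha
    exact ⟨u, hu, (jn_ftype_iff τ X u i).2 h⟩

/-- Negative form of `inW_ftype_iff`. [this work] -/
theorem not_inW_ftype_iff (X : Finset (Sym2 V)) (U : Finset (Fin 4)) (i : Fin 4) :
    inW (ftype τ X) U i = false ↔ τ i ∉ clS X (roots τ U) := by
  rw [← inW_ftype_iff]; exact Bool.eq_false_iff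

/-- **Larger mask, larger explored set.** [this work] -/
theorem clS_roots_subset_of_mask {X : Finset (Sym2 V)} {U U' : Finset (Fin 4)}
    (h : ∀ i, inW (ftype τ X) U i = true → inW (ftype τ X) U' i = true) :
    clS X (roots τ U) ⊆ clS X (roots τ U') := by
  intro x hx
  obtain ⟨a, ha, hxa⟩ := mem_clS.1 hx
  obtain ⟨u, hu, rfl⟩ := Finset.mem_image.1 ha
  have hu' : inW (ftype τ X) U' u = true :=
    h u ((inW_ftype_iff τ X U u).2 (mem_clS.2 ⟨τ u, Finset.mem_image_of_mem τ hu, mem_cl_self X _⟩))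
  exact cl_subset_clS ((inW_ftype_iff τ X U' u).1 hu') hxa

/-- A vertex of `W` is alone in `ω ∖ touch W` (no pair at it survives). [folklore] -/
theorem eq_of_mem_cl_sdiff_touch {ω : Finset (Sym2 V)} {W : Finset V} {w w' : V} (hw : w ∈ W)
    (h : w' ∈ cl (ω \ touch W) w) : w' = w := by
  classical
  obtain ⟨p⟩ := mem_cl.1 h
  cases p with
  | nil => rfl
  | cons hadj _ =>
    exfalso
    rw [adj_iff, Finset.mem_sdiff, mk_mem_touch, not_or] at hadj
    exact hadj.1.2.1 hw

/-- **Root-block constraint.** A terminal inside `W = clS X (roots τ U)` is joined in `T ∖ touch W` only to terminals equal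
to it, hence `X`-joined to them. [this work] -/
theorem rootBlock_ftype (X T : Finset (Sym2 V)) (U : Finset (Fin 4)) (i j : Fin 4)
    (hi : inW (ftype τ X) U i = true) (hij : jn (ftype τ (T \ touch (clS X (roots τ U)))) i j = true) :
    jn (ftype τ X) i j = true := by
  rw [jn_ftype_iff] at hij ⊢
  have e := eq_of_mem_cl_sdiff_touch ((inW_ftype_iff τ X U i).1 hi) hij
  rw [e]; exact mem_cl_self X _

/-! ### Clean outputs (F1, F2) -/

/-- **CLEAN OUTPUT RULE.**  For `W = clS X (roots τ U)`, the type of `X on touch W, T elsewhere` is admissible: inside `W`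
the blocks are the `X`-blocks (F1 `cl_splice_touch_clS`), outside `W` they are the blocks of `T ∖ touch W` (F2
`mem_cl_splice_touch_clS_iff_of_not_mem`), and an avoiding path never enters `W`. [this work] -/
theorem admClean_ftype (X T : Finset (Sym2 V)) (U : Finset (Fin 4)) :
    admClean (ftype τ X) (inW (ftype τ X) U) (ftype τ (T \ touch (clS X (roots τ U))))
      (ftype τ (splice (touch (clS X (roots τ U))) X T)) = true := by
  rw [admClean, decide_eq_true_iff]
  intro i j
  cases hi : inW (ftype τ X) U i
  · -- `τ i ∉ W`
    have hiW : τ i ∉ clS X (roots τ U) := (not_inW_ftype_iff τ X U i).1 hi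
    have key := jn_eq_jn_of_iff τ (i := i) (j := j) (i' := i) (j' := j)
      (mem_cl_splice_touch_clS_iff_of_not_mem (ω := T) hiW (τ j))
    rw [key]
    cases hp : jn (ftype τ (T \ touch (clS X (roots τ U)))) i j
    · simp
    · have hjW : τ j ∉ clS X (roots τ U) := not_mem_of_mem_cl_sdiff_touch hiW ((jn_ftype_iff τ _ i j).1 hp)
      have hj : inW (ftype τ X) U j = false := (not_inW_ftype_iff τ X U j).2 hjW
      simp [hj]
  · -- `τ i ∈ W`
    have hiW : τ i ∈ clS X (roots τ U) := (inW_ftype_iff τ X U i).1 hi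
    have key := jn_eq_jn_of_iff τ (i := i) (j := j) (i' := i) (j' := j)
      (show τ j ∈ cl (splice (touch (clS X (roots τ U))) X T) (τ i) ↔ τ j ∈ cl X (τ i) by
        rw [cl_splice_touch_clS T hiW])
    rw [key]; simp

/-! ### Messy outputs (F4) -/

/-- **Extra joins go through the re-explored cluster.**  In `o = X on F, T elsewhere` with `F ⊆ touch B`, `B = cl X v`,
where the `X`-cluster `B` survives (`B ⊆ cl o v`): if `v ∉ cl o x` then the `o`-cluster of `x` is its cluster in
`T ∖ touch B` (it never meets `B`, so it uses no pair of `touch B`, where `o` might differ from `T`). [this work] -/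
theorem cl_eq_cl_sdiff_touch_of_not_mem {X T F : Finset (Sym2 V)} {B : Finset V} {v x : V} (hF : F ⊆ touch B)
    (hB : B ⊆ cl (splice F X T) v) (hv : v ∉ cl (splice F X T) x) :
    cl (splice F X T) x = cl (T \ touch B) x := by
  classical
  set o := splice F X T with ho
  -- the cluster of `x` does not meet `B`
  have hdis : ∀ z ∈ cl o x, z ∉ B := fun z hz hzB =>
    hv (mem_cl_trans hz (mem_cl_comm.1 (hB hzB)))
  symm
  refine cl_eq_of_agree fun e he => ?_
  -- `e` touches the cluster of `x`; if `e ∈ o` both endpoints are in the cluster, so `e ∉ touch B`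
  constructor
  · intro heo
    refine Finset.mem_sdiff.2 ⟨?_, fun heB => ?_⟩
    · by_contra heT
      have heF : e ∈ F := by
        by_contra heF
        exact heT ((mem_splice_of_not_mem heF).1 heo)
      -- `e ∈ F ⊆ touch B` and `e ∈ o`: an endpoint in `B`, and `e` touches the cluster of `x`
      obtain ⟨b, hbB, hbe⟩ := mem_touch.1 (hF heF)
      obtain ⟨z, hz, hze⟩ := mem_touch.1 he
      have hb : b ∈ cl o x := by
        induction e using Sym2.ind with
        | h p q =>
          rcases Sym2.mem_iff.1 hze with rfl | rfl <;> rcases Sym2.mem_iff.1 hbe with rfl | rfl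
          · exact hz
          · by_cases hzb : z = b
            · exact hzb ▸ hz
            · exact mem_cl_of_adj hz (adj_iff.2 ⟨heo, hzb⟩)
          · by_cases hzb : z = b
            · exact hzb ▸ hz
            · exact mem_cl_of_adj hz (adj_iff.2 ⟨by rw [Sym2.eq_swap]; exact heo, hzb⟩)
          · exact hz
      exact hdis b hb hbB
    · obtain ⟨b, hbB, hbe⟩ := mem_touch.1 heB
      obtain ⟨z, hz, hze⟩ := mem_touch.1 he
      have hb : b ∈ cl o x := by
        induction e using Sym2.ind with
        | h p q =>
          rcases Sym2.mem_iff.1 hze with rfl | rfl <;> rcases Sym2.mem_iff.1 hbe with rfl | rfl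
          · exact hz
          · by_cases hzb : z = b
            · exact hzb ▸ hz
            · exact mem_cl_of_adj hz (adj_iff.2 ⟨heo, hzb⟩)
          · by_cases hzb : z = b
            · exact hzb ▸ hz
            · exact mem_cl_of_adj hz (adj_iff.2 ⟨by rw [Sym2.eq_swap]; exact heo, hzb⟩)
          · exact hz
      exact hdis b hb hbB
  · intro heT
    rw [Finset.mem_sdiff] at heT
    exact (mem_splice_of_not_mem fun heF => heT.2 (hF heF)).2 heT.1

/-- **MESSY OUTPUT RULE.**  For `W = clS X (roots τ U)` (first step) and a second root `v`, the type of
`o = X on touch (clS X {τ v}) ∖ touch W, T elsewhere` is admissible: if `τ v ∈ W` then `o = T`; otherwise the `X`-block of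
`v` is one block of `o` (F4 i), the blocks of `T ∖ touch (cl X (τ v))` are joined in `o` (F4 ii), and any other join of `o`
goes through `v` (`cl_eq_cl_sdiff_touch_of_not_mem`). [this work] -/
theorem admMessy_ftype (X T : Finset (Sym2 V)) (U : Finset (Fin 4)) (v : Fin 4) :
    admMessy (ftype τ X) (inW (ftype τ X) U) v (ftype τ T) (ftype τ (T \ touch (clS X (roots τ {v}))))
      (ftype τ (splice (touch (clS X (roots τ {v})) \ touch (clS X (roots τ U))) X T)) = true := by
  have hrv : roots τ {v} = {τ v} := by simp [roots]
  rw [admMessy]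
  cases hv : inW (ftype τ X) U v
  · -- `τ v ∉ W`: conditions M1, M2, M3
    have hvW : τ v ∉ clS X (roots τ U) := (not_inW_ftype_iff τ X U v).1 hv
    set F := touch (clS X (roots τ {v})) \ touch (clS X (roots τ U)) with hFdef
    have hFB : F ⊆ touch (cl X (τ v)) := by
      intro e he; rw [hFdef, Finset.mem_sdiff, hrv, clS_singleton] at he; exact he.1
    have hXg : X ∉ gconn (roots τ U) (roots τ {v}) := by
      rw [hrv]; intro h
      obtain ⟨a, ha, b, hb, hab⟩ := mem_gconn.1 h
      rw [Finset.mem_singleton] at hb; subst hb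
      exact hvW (mem_clS.2 ⟨a, ha, hab⟩)
    -- (F4 i): the `X`-cluster of `τ v` survives in `o`
    have hBo : cl X (τ v) ⊆ cl (splice F X T) (τ v) :=
      cl_subset_cl_splice_sdiff_clS hXg (by rw [hrv, clS_singleton]; exact mem_cl_self X _) T
    simp only [Bool.not_false, Bool.true_and, Bool.false_and, Bool.false_or, decide_eq_true_iff]
    refine ⟨fun i j hi hj => ?_, fun i j hij => ?_, fun i j hij hp => ?_⟩
    · -- M1
      rw [jn_ftype_iff] at hi hj ⊢
      exact mem_cl_trans (mem_cl_comm.1 (hBo hi)) (hBo hj)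
    · -- M2
      rw [jn_ftype_iff] at hij ⊢
      rw [hrv, clS_singleton] at hij
      exact cl_sdiff_touch_subset_cl_splice hFB (τ i) hij
    · -- M3
      rw [jn_ftype_iff] at hij ⊢
      rw [Bool.eq_false_iff, ne_eq, jn_ftype_iff, hrv, clS_singleton] at hp
      by_contra hvi
      rw [cl_eq_cl_sdiff_touch_of_not_mem hFB hBo hvi] at hij
      exact hp hij
  · -- `τ v ∈ W`: the region is empty and `o = T`
    have hvW : τ v ∈ clS X (roots τ U) := (inW_ftype_iff τ X U v).1 hv
    have hF : touch (clS X (roots τ {v})) \ touch (clS X (roots τ U)) = ∅ := by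
      rw [hrv, clS_singleton, Finset.sdiff_eq_empty_iff_subset]
      exact touch_mono (cl_subset_clS hvW)
    rw [hF, splice_empty]
    simp

end SwitchRelax

end Summit.CriticalPhenomena.PercolationContinuityZ3.Theorems

end
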